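import Summits.QuantumFields.BalabanUV.Beta.FP.BlockAveragedRemainderSource
import Summits.QuantumFields.BalabanUV.Beta.FP.ConstrainedGhostIRWindow

/-!
# Road FP (binder row D1), row H′2-IR — IR-Q ∕ IR-1 SUPPLEMENT (R-FP-20): THE WINDOW FORM (T2-win) OF `R^Q = A·G_C·Aᵀ` AT BAŁABAN's
# STRAIGHT-CONTOUR AVERAGE — `Σ_{x ∈ window of radius n} |Δ_νΔ_μ R^Q((x,μ′),(y,ν′))| ≤ C` LOG-FREE, from the leg's FIRST-difference letter only;
# PART 1: the degree-`s` window lemma, the contour average as a mean of shifted block averages, THE AXIAL WINDOW LETTER (our bookkeeping)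

HONEST DEPENDENCY (page 1, mandatory): continuum YM on T⁴ ⇐ BetaPertH ∧ nine spine estimates (0/9 proved); BetaPertH ⇐ (D1) ∧ (D4) ∧
CAP+tail; G-an2-4 gates asym, D1 and NE2/3/4.  HONEST FRAMING (cell contract, verbatim): «discharging `BetaPertH` makes Bałaban's UV
stability UNCONDITIONAL — a real constructive-QFT result; it is NOT the continuum limit and NOT the Clay problem.»  THIS MODULE is
[folklore]∕our bookkeeping on `ℤ⁴`: it imports this lineage's IR-Q files (`BlockAveragedRemainder{,Axial,Source}`)
and leaf-05-g9's IR-4a (T2-win) brick `FP/ConstrainedGhostIRWindow.sum_box_abs_blockAvg_fwdDiff₂_le_profile` (the block-average window letter WITH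
the coarse profile, generic kernel) BY NAME; it cites nothing, declares no `def`, mints no `def … : Prop`, has 0 `sorry`.  Kernels are ARBITRARY with
displayed letters; the coarse inverse `G` is ALWAYS hypothetical (IR-2 (iv)(v)); the `P^{BF} := Re PinfKer` instance is in `FP/BlockAveragedPropagatorWindow`.  R-FP-20 (owner d1-p3-g5):
second differences are consumed as WINDOW sums (log-free), not sup norms (which carry the genuine block-edge `log n`); this file delivers the window
form for `R^Q` from the FIRST-difference letter (P1) alone — no second-difference letter of `P^{BF}` (KER-ASM v1.1's (K3)) is needed.  It discharges
NOTHING of row H′2-IR ∕ `ρ_a` ∕ `hasym` ∕ D1 ∕ `BetaPertH`; NEVER «G-an2-4 closed»; NOT (CONV-C), NOT D1, NOT the continuum limit, NOT Clay.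

ABSOLUTE RULE (cell charter, verbatim): «No internally-minted statement may enter as a cited fact. Every hypothesis is either
kernel-proved in this package or a verbatim quotation of a PUBLISHED theorem with page reference. The manuscript(s) under audit are NOT
citable for their own disputed steps — they are the thing under adjudication; programme-internal (2001/route/tribunal) claims are never
citable.»

CONTENT (`Pt = ℤ⁴`, sup norm; `box 4 R` = the sup-box of radius `R`; `n ≥ 1`).
* §1 `sum_abs_sum_rem_le_of_window'` — PART A's window lemma with the window letter of ANY degree `s ≥ 2` (PART A fixed `s = 4`; the axial letter has `s = 3`).
* §2 `axialAvg_eq_avg_blockAvg_shift` — the straight-contour average is the mean over the contour position `j < n` of the plain block average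
  shifted by `j·e_α`: `axialAvg n α f u = n⁻¹ Σ_{j<n} n⁻⁴·blockSum n (y ↦ f (y + j·e_α)) u`.
* §3 **`sum_box_abs_axialAvg_fwdDiff₂_le_profile`** — THE AXIAL WINDOW LETTER: `|Δ_μP| ≤ C₁(‖z‖∞+1)⁻³` ⟹
  `Σ_{q∈box 4 n} |Δ_νΔ_μ axialAvg n α (t ↦ P(n•w + q − t)) v| ≤ 9·82944·C₁∕(‖v − w‖∞+1)³` (shift by `j·e_α`, `j < n`, moves the radius-`n` window into
  the union of the windows of the blocks `w` and `w − e_α`; leaf-05-g9's block letter on each).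
* The instance for `R^Q` at `axialAvg` (four-term window lemma, re-centring of the window's legs) is the sibling `FP/BlockAveragedRemainderWindowAxial`;
  the `P^{BF}` instance is `FP/BlockAveragedPropagatorWindow`.
Unit `b2b-balaban-gan24-formalise-leaf-04` (gen 40; cross-lane idle G-an2-4 swarm leaf seat on road FP), 2026-08-20; rows IR-Q (l.236) ∕ IR-1 (l.212) of `LEAVES-FP.md`.
-/

namespace Summit.QuantumFields.BalabanUV.Beta.FP.BlockAveragedRemainderWindow

open Finset
open scoped BigOperators
open Literature.Probability.LatticeModels (box)
open Literature.MathematicalPhysics.QuantumFieldTheory.Balaban1983to89.Beta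
open Literature.MathematicalPhysics.QuantumFieldTheory.Balaban1983to89.Beta.DyadicShell (Pt supNorm mem_box_iff supNorm_le_iff natAbs_le_supNorm
  natAbs_le_iff_mem supNorm_eq_zero_iff)
open Literature.MathematicalPhysics.QuantumFieldTheory.Balaban1983to89.Beta.GradedBubbles (supNorm_neg)
open Literature.MathematicalPhysics.QuantumFieldTheory.Balaban1983to89.Beta.AffineAveraging (blockSum toSite)
open Literature.MathematicalPhysics.QuantumFieldTheory.Balaban1983to89.Beta.AxialBlockWeights (idx pt pt_apply fineBlock mem_fineBlock card_idx)
open Literature.MathematicalPhysics.QuantumFieldTheory.Balaban1983to89.Beta.AxialComposition (axialAvg)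
open Literature.MathematicalPhysics.QuantumFieldTheory.LatticeForm (quo)
open Summit.QuantumFields.BalabanUV.Beta.FP.LatticeConvolutionBounds (nonneg_of_abs_le_div exp_neg_supNorm_le_div_pow one_le_supNorm_add_one)
open Summit.QuantumFields.BalabanUV.Beta.FP.BlockAveragedKernel (letter_nonneg_of_le supNorm_le_supNorm_sub_add)
open Summit.QuantumFields.BalabanUV.Beta.FP.BlockAveragedKernelScalar (sum_affineBox_eq_sum_fineBlock)
open Summit.QuantumFields.BalabanUV.Beta.FP.ConstrainedGhostIRLetters (zsmul_natCast_eq_nsmul supNorm_quo_sub_quo_le_one red_bounds)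
open Summit.QuantumFields.BalabanUV.Beta.FP.ConstrainedGhostIRWindow (sum_box_abs_blockAvg_fwdDiff₂_le_profile)
open Summit.QuantumFields.BalabanUV.Beta.FP.BlockAveragedRemainder (abs_tsum_sum_mul_le tsum_sum_abs_mul_le)
open Summit.QuantumFields.BalabanUV.Beta.FP.BlockAveragedRemainderAxial (leg_letter abs_multQ_le)

noncomputable section

variable {ι : Type*} [Fintype ι]

/-! ## §1 The window lemma with a window letter of any degree `s ≥ 2` -/

/-- [folklore] **(T2-win) WITH A DEGREE-`s` WINDOW LETTER** (`s ≥ 2`; PART A's `sum_abs_sum_rem_le_of_window` is the case `s = 4`): for a finite index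
set `X` with legs `leg x k`, a window letter `Σ_{x∈X} |Σ_k coef k·leg x k α u| ≤ aW∕(‖u−p‖∞+1)^s` and a degree-3 multiplier letter,
`Σ_{x∈X} |Σ_k coef k·R_{x,k}| ≤ |ι|·162·aW·K`. -/
theorem sum_abs_sum_rem_le_of_window' {m : ℕ} (X : Finset Pt) (coef : Fin m → ℝ) (leg : Pt → Fin m → ι → Pt → ℝ)
    {W : ι → Pt → ℝ} {a₀ aW K : ℝ} {p w : Pt} {s : ℕ} (hs : 2 ≤ s)
    (hleg : ∀ x k α u, |leg x k α u| ≤ a₀ / ((supNorm (u - p) : ℝ) + 1) ^ 2)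
    (hwin : ∀ α u, ∑ x ∈ X, |∑ k, coef k * leg x k α u| ≤ aW / ((supNorm (u - p) : ℝ) + 1) ^ s)
    (hW : ∀ α u, |W α u| ≤ K / ((supNorm (u - w) : ℝ) + 1) ^ 3) :
    ∑ x ∈ X, |∑ k, coef k * ∑' u, ∑ α, leg x k α u * W α u| ≤ (Fintype.card ι : ℝ) * 162 * aW * K := by
  have hk : ∀ x k, Summable (fun u => ∑ α, leg x k α u * W α u) :=
    fun x k => (abs_tsum_sum_mul_le (s := 2) (t := 3) (by norm_num) p w (hleg x k) hW).1
  have hswap : ∀ x, ∑ k, coef k * ∑' u, ∑ α, leg x k α u * W α u = ∑' u, ∑ α, (∑ k, coef k * leg x k α u) * W α u := by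
    intro x
    have h1 : ∀ k, coef k * ∑' u, ∑ α, leg x k α u * W α u = ∑' u, coef k * ∑ α, leg x k α u * W α u :=
      fun k => (tsum_mul_left).symm
    simp_rw [h1]
    rw [← Summable.tsum_finsetSum fun k _ => (hk x k).mul_left (coef k)]
    refine tsum_congr fun u => ?_
    simp_rw [Finset.mul_sum, Finset.sum_mul]
    rw [Finset.sum_comm]
    refine Finset.sum_congr rfl fun α _ => Finset.sum_congr rfl fun k _ => ?_
    ring
  have hcombx : ∀ x ∈ X, ∀ α u, |∑ k, coef k * leg x k α u| ≤ aW / ((supNorm (u - p) : ℝ) + 1) ^ s := by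
    intro x hx α u
    exact (Finset.single_le_sum (f := fun x => |∑ k, coef k * leg x k α u|) (fun _ _ => abs_nonneg _) hx).trans (hwin α u)
  set F : ι → Pt → ℝ := fun α u => ∑ x ∈ X, |∑ k, coef k * leg x k α u| with hF
  have hFle : ∀ α u, |F α u| ≤ aW / ((supNorm (u - p) : ℝ) + 1) ^ s := fun α u => by
    rw [hF, abs_of_nonneg (Finset.sum_nonneg fun _ _ => abs_nonneg _)]; exact hwin α u
  have hmaj := tsum_sum_abs_mul_le (s := s) (t := 3) (by omega) p w hFle hW
  have hx : ∀ x ∈ X, Summable (fun u => ∑ α, |∑ k, coef k * leg x k α u| * |W α u|)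
      ∧ |∑' u, ∑ α, (∑ k, coef k * leg x k α u) * W α u| ≤ ∑' u, ∑ α, |∑ k, coef k * leg x k α u| * |W α u| := by
    intro x hxX
    have hs' := tsum_sum_abs_mul_le (s := s) (t := 3) (by omega) p w (hcombx x hxX) hW
    refine ⟨hs'.1, ?_⟩
    have hsum := (abs_tsum_sum_mul_le (a := fun α u => ∑ k, coef k * leg x k α u) (s := s) (t := 3) (by omega) p w
      (hcombx x hxX) hW).1
    calc |∑' u, ∑ α, (∑ k, coef k * leg x k α u) * W α u| = ‖∑' u, ∑ α, (∑ k, coef k * leg x k α u) * W α u‖ := (Real.norm_eq_abs _).symm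
      _ ≤ ∑' u, ‖∑ α, (∑ k, coef k * leg x k α u) * W α u‖ := norm_tsum_le_tsum_norm hsum.norm
      _ ≤ ∑' u, ∑ α, |∑ k, coef k * leg x k α u| * |W α u| := by
          refine hsum.norm.tsum_le_tsum (fun u => ?_) hs'.1
          rw [Real.norm_eq_abs]
          refine (Finset.abs_sum_le_sum_abs _ _).trans (le_of_eq ?_)
          exact Finset.sum_congr rfl fun α _ => abs_mul _ _
  calc ∑ x ∈ X, |∑ k, coef k * ∑' u, ∑ α, leg x k α u * W α u|
      = ∑ x ∈ X, |∑' u, ∑ α, (∑ k, coef k * leg x k α u) * W α u| := Finset.sum_congr rfl fun x _ => by rw [hswap x]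
    _ ≤ ∑ x ∈ X, ∑' u, ∑ α, |∑ k, coef k * leg x k α u| * |W α u| := Finset.sum_le_sum fun x hxX => (hx x hxX).2
    _ = ∑' u, ∑ x ∈ X, ∑ α, |∑ k, coef k * leg x k α u| * |W α u| :=
        (Summable.tsum_finsetSum fun x hxX => (hx x hxX).1).symm
    _ = ∑' u, ∑ α, |F α u| * |W α u| := by
        refine tsum_congr fun u => ?_
        rw [Finset.sum_comm]
        refine Finset.sum_congr rfl fun α _ => ?_
        have hFabs : |F α u| = ∑ x ∈ X, |∑ k, coef k * leg x k α u| := by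
          rw [hF]; exact abs_of_nonneg (Finset.sum_nonneg fun _ _ => abs_nonneg _)
        rw [hFabs, Finset.sum_mul]
    _ ≤ (Fintype.card ι : ℝ) * 162 * aW * K := hmaj.2

/-! ## §2 The straight-contour average is the mean of shifted block averages -/

/-- [folklore] `pt α (m, j) = m + j·e_α`. -/
theorem pt_eq_add_smul (α : Fin 4) (m : Pt) (j : ℕ) : pt α (m, j) = m + (j : ℤ) • (Pi.single α (1 : ℤ) : Pt) := by
  funext i
  rw [pt_apply]
  by_cases h : i = α
  · subst h; simp
  · simp [h]

/-- **THE CONTOUR AVERAGE AS A MEAN OF SHIFTED BLOCK AVERAGES** [our bookkeeping]: for `n ≥ 1`,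
`axialAvg n α f u = n⁻¹·Σ_{j<n} n⁻⁴·blockSum n (y ↦ f (y + j·e_α)) u`. -/
theorem axialAvg_eq_avg_blockAvg_shift {n : ℕ} (hn : 1 ≤ n) (α : Fin 4) (f : Pt → ℝ) (u : Pt) :
    axialAvg n α f u
      = ((n : ℝ))⁻¹ * ∑ j ∈ Finset.range n, ((n : ℝ) ^ 4)⁻¹ * blockSum n (fun y => f (y + (j : ℤ) • (Pi.single α (1 : ℤ) : Pt))) u := by
  have hn0 : (n : ℝ) ≠ 0 := by exact_mod_cast (show n ≠ 0 by omega)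
  unfold axialAvg
  rw [show idx n = fineBlock n ×ˢ Finset.range n from rfl, Finset.sum_product, Finset.sum_comm]
  have hblock : ∀ j ∈ Finset.range n, ((n : ℝ) ^ 4)⁻¹ * blockSum n (fun y => f (y + (j : ℤ) • (Pi.single α (1 : ℤ) : Pt))) u
      = ((n : ℝ) ^ 4)⁻¹ * ∑ m ∈ fineBlock n, f (n • u + pt α (m, j)) := by
    intro j _
    congr 1
    simp only [blockSum]
    rw [sum_affineBox_eq_sum_fineBlock n (fun m => f ((n : ℤ) • u + m + (j : ℤ) • (Pi.single α (1 : ℤ) : Pt)))]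
    refine Finset.sum_congr rfl fun m _ => ?_
    rw [pt_eq_add_smul, zsmul_natCast_eq_nsmul, add_assoc]
  rw [Finset.sum_congr rfl hblock, ← Finset.mul_sum, ← mul_assoc, Finset.sum_div]
  rw [← mul_inv, show (n : ℝ) * (n : ℝ) ^ 4 = (n : ℝ) ^ 5 by ring]
  rw [Finset.mul_sum]
  refine Finset.sum_congr rfl fun j _ => ?_
  rw [div_eq_inv_mul]

/-! ## §3 The axial window letter -/

/-- [folklore] membership split for the shifted window: `q ∈ box 4 n`, `j < n` ⟹ `q − j·e_α ∈ box 4 n` or `q − j·e_α + n·e_α ∈ box 4 n`. -/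
theorem shift_mem_box_or {n : ℕ} {q : Pt} (hq : q ∈ box 4 n) (α : Fin 4) {j : ℕ} (hj : j < n) :
    q - (j : ℤ) • (Pi.single α (1 : ℤ) : Pt) ∈ box 4 n
      ∨ q - (j : ℤ) • (Pi.single α (1 : ℤ) : Pt) + (n : ℤ) • (Pi.single α (1 : ℤ) : Pt) ∈ box 4 n := by
  rw [mem_box_iff, supNorm_le_iff] at hq
  have hqi : ∀ i, -(n : ℤ) ≤ q i ∧ q i ≤ n := fun i => natAbs_le_iff_mem.mp (hq i)
  by_cases hcase : -(n : ℤ) ≤ q α - j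
  · left
    rw [mem_box_iff, supNorm_le_iff]
    intro i
    refine natAbs_le_iff_mem.mpr ?_
    by_cases h : i = α
    · subst h; simp; constructor <;> [linarith; linarith [(hqi i).2]]
    · simp [h]; exact hqi i
  · right
    rw [not_le] at hcase
    rw [mem_box_iff, supNorm_le_iff]
    intro i
    refine natAbs_le_iff_mem.mpr ?_
    by_cases h : i = α
    · subst h; simp
      have := (hqi i).1
      have hj' : (j : ℤ) < n := by exact_mod_cast hj
      constructor <;> linarith
    · simp [h]; exact hqi i

/-- [folklore] A shifted window sum of a non-negative function is dominated by the window sums of the two neighbouring blocks: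
`Σ_{q∈box 4 n} g(n•w + q − j·e_α) ≤ Σ_{q∈box 4 n} g(n•w + q) + Σ_{q∈box 4 n} g(n•(w − e_α) + q)` for `j < n`, `g ≥ 0`. -/
theorem sum_box_shift_le {n : ℕ} (g : Pt → ℝ) (hg : ∀ x, 0 ≤ g x) (w : Pt) (α : Fin 4) {j : ℕ} (hj : j < n) :
    ∑ q ∈ box 4 n, g (n • w + q - (j : ℤ) • (Pi.single α (1 : ℤ) : Pt))
      ≤ ∑ q ∈ box 4 n, g (n • w + q) + ∑ q ∈ box 4 n, g (n • (w - Pi.single α 1) + q) := by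
  classical
  set e : Pt := (Pi.single α (1 : ℤ) : Pt) with he
  -- split the window according to the membership alternative
  set S₁ := (box 4 n).filter (fun q => q - (j : ℤ) • e ∈ box 4 n) with hS₁
  set S₂ := (box 4 n).filter (fun q => ¬ (q - (j : ℤ) • e ∈ box 4 n)) with hS₂
  have hsplit : ∑ q ∈ box 4 n, g (n • w + q - (j : ℤ) • e)
      = ∑ q ∈ S₁, g (n • w + q - (j : ℤ) • e) + ∑ q ∈ S₂, g (n • w + q - (j : ℤ) • e) := by
    rw [hS₁, hS₂, ← Finset.sum_filter_add_sum_filter_not (box 4 n) (fun q => q - (j : ℤ) • e ∈ box 4 n)]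
  rw [hsplit]
  -- first part: reindex by `q ↦ q − j•e` (injective) into `box 4 n`
  have h1 : ∑ q ∈ S₁, g (n • w + q - (j : ℤ) • e) ≤ ∑ q ∈ box 4 n, g (n • w + q) := by
    have hinj : Set.InjOn (fun q : Pt => q - (j : ℤ) • e) S₁ := fun a _ b _ h => by simpa using h
    have himg : ∑ q' ∈ S₁.image (fun q : Pt => q - (j : ℤ) • e), g (n • w + q') = ∑ q ∈ S₁, g (n • w + (q - (j : ℤ) • e)) :=
      Finset.sum_image hinj
    rw [show ∑ q ∈ S₁, g (n • w + q - (j : ℤ) • e) = ∑ q ∈ S₁, g (n • w + (q - (j : ℤ) • e)) from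
      Finset.sum_congr rfl fun q _ => by rw [add_sub_assoc], ← himg]
    refine Finset.sum_le_sum_of_subset_of_nonneg ?_ (fun _ _ _ => hg _)
    intro q' hq'
    obtain ⟨q, hq, rfl⟩ := Finset.mem_image.mp hq'
    exact (Finset.mem_filter.mp hq).2
  -- second part: reindex by `q ↦ q − j•e + n•e` (injective) into `box 4 n`, block `w − e`
  have h2 : ∑ q ∈ S₂, g (n • w + q - (j : ℤ) • e) ≤ ∑ q ∈ box 4 n, g (n • (w - Pi.single α 1) + q) := by
    have hinj : Set.InjOn (fun q : Pt => q - (j : ℤ) • e + (n : ℤ) • e) S₂ := fun a _ b _ h => by simpa using h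
    have hns : ∀ q : Pt, n • w + q - (j : ℤ) • e = n • (w - Pi.single α 1) + (q - (j : ℤ) • e + (n : ℤ) • e) := by
      intro q
      rw [← zsmul_natCast_eq_nsmul, ← zsmul_natCast_eq_nsmul, smul_sub, he]; abel
    have himg : ∑ q' ∈ S₂.image (fun q : Pt => q - (j : ℤ) • e + (n : ℤ) • e), g (n • (w - Pi.single α 1) + q')
        = ∑ q ∈ S₂, g (n • (w - Pi.single α 1) + (q - (j : ℤ) • e + (n : ℤ) • e)) := Finset.sum_image hinj
    rw [show ∑ q ∈ S₂, g (n • w + q - (j : ℤ) • e) = ∑ q ∈ S₂, g (n • (w - Pi.single α 1) + (q - (j : ℤ) • e + (n : ℤ) • e))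
      from Finset.sum_congr rfl fun q _ => by rw [hns], ← himg]
    refine Finset.sum_le_sum_of_subset_of_nonneg ?_ (fun _ _ _ => hg _)
    intro q' hq'
    obtain ⟨q, hq, rfl⟩ := Finset.mem_image.mp hq'
    have hq2 := Finset.mem_filter.mp hq
    rcases shift_mem_box_or hq2.1 α hj with h | h
    · exact absurd h hq2.2
    · rw [he]; exact h
  exact add_le_add h1 h2

/-- **THE AXIAL WINDOW LETTER** [our bookkeeping]: `|P(z+e_μ) − P z| ≤ C₁∕(‖z‖∞+1)³`, `n ≥ 1` ⟹ for every contour direction `α`, every window block `w`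
and every coarse block `v`,
`Σ_{q∈box 4 n} |Δ_νΔ_μ axialAvg n α (t ↦ P(n•w + q − t)) v| ≤ 9·82944·C₁∕(‖v − w‖∞+1)³` — log-free (leaf-05-g9's block window letter
`sum_box_abs_blockAvg_fwdDiff₂_le_profile` on the two neighbouring blocks of each contour shift, §2). -/
theorem sum_box_abs_axialAvg_fwdDiff₂_le_profile {P : Pt → ℝ} {C₁ : ℝ} (μ ν : Fin 4)
    (hΔ : ∀ z, |P (z + Pi.single μ 1) - P z| ≤ C₁ / ((supNorm z : ℝ) + 1) ^ 3) {n : ℕ} (hn : 1 ≤ n) (α : Fin 4) (w v : Pt) :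
    ∑ q ∈ box 4 n, |axialAvg n α (fun t => P (n • w + q + Pi.single ν 1 + Pi.single μ 1 - t)) v
        - axialAvg n α (fun t => P (n • w + q + Pi.single ν 1 - t)) v
        - axialAvg n α (fun t => P (n • w + q + Pi.single μ 1 - t)) v
        + axialAvg n α (fun t => P (n • w + q - t)) v|
      ≤ 9 * 82944 * C₁ / ((supNorm (v - w) : ℝ) + 1) ^ 3 := by
  have hn0 : (0 : ℝ) < n := by exact_mod_cast hn
  have hC : 0 ≤ C₁ := letter_nonneg_of_le (K := fun z => P (z + Pi.single μ 1) - P z) hΔ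
  -- the block leg and its second difference as functions of the fine point
  set A : Pt → ℝ := fun x => ((n : ℝ) ^ 4)⁻¹ * blockSum n (fun y => P (x - y)) v with hA
  set D : Pt → ℝ := fun x => A (x + Pi.single ν 1 + Pi.single μ 1) - A (x + Pi.single ν 1) - A (x + Pi.single μ 1) + A x with hD
  -- the axial leg at `x` is the mean over `j` of `A (x − j•e)`
  have hax : ∀ x : Pt, axialAvg n α (fun t => P (x - t)) v = ((n : ℝ))⁻¹ * ∑ j ∈ Finset.range n, A (x - (j : ℤ) • (Pi.single α (1 : ℤ) : Pt)) := by
    intro x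
    rw [axialAvg_eq_avg_blockAvg_shift hn α (fun t => P (x - t)) v]
    congr 1
    refine Finset.sum_congr rfl fun j _ => ?_
    simp only [hA]
    congr 2
    funext y
    congr 1
    abel
  -- hence the second difference of the axial leg at `x` is the mean of `D (x − j•e)`
  have hcomb : ∀ x : Pt,
      axialAvg n α (fun t => P (x + Pi.single ν 1 + Pi.single μ 1 - t)) v - axialAvg n α (fun t => P (x + Pi.single ν 1 - t)) v
        - axialAvg n α (fun t => P (x + Pi.single μ 1 - t)) v + axialAvg n α (fun t => P (x - t)) v
      = ((n : ℝ))⁻¹ * ∑ j ∈ Finset.range n, D (x - (j : ℤ) • (Pi.single α (1 : ℤ) : Pt)) := by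
    intro x
    rw [hax, hax, hax, hax, ← mul_sub, ← mul_sub, ← mul_add, ← Finset.sum_sub_distrib, ← Finset.sum_sub_distrib, ← Finset.sum_add_distrib]
    congr 1
    refine Finset.sum_congr rfl fun j _ => ?_
    simp only [hD]
    have e1 : x + Pi.single ν 1 + Pi.single μ 1 - (j : ℤ) • (Pi.single α (1 : ℤ) : Pt) = x - (j : ℤ) • (Pi.single α (1 : ℤ) : Pt) + Pi.single ν 1 + Pi.single μ 1 := by abel
    have e2 : x + Pi.single ν 1 - (j : ℤ) • (Pi.single α (1 : ℤ) : Pt) = x - (j : ℤ) • (Pi.single α (1 : ℤ) : Pt) + Pi.single ν 1 := by abel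
    have e3 : x + Pi.single μ 1 - (j : ℤ) • (Pi.single α (1 : ℤ) : Pt) = x - (j : ℤ) • (Pi.single α (1 : ℤ) : Pt) + Pi.single μ 1 := by abel
    rw [e1, e2, e3]
  -- leaf-05-g9's block window letter at the blocks `w` and `w − e`
  have hblk : ∀ w' : Pt, ∑ q ∈ box 4 n, |D (n • w' + q)| ≤ 82944 * C₁ / ((supNorm (v - w') : ℝ) + 1) ^ 3 := by
    intro w'
    have h := sum_box_abs_blockAvg_fwdDiff₂_le_profile μ ν hΔ hn w' v
    simpa only [hD, hA] using h
  -- the window sum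
  calc ∑ q ∈ box 4 n, |axialAvg n α (fun t => P (n • w + q + Pi.single ν 1 + Pi.single μ 1 - t)) v
        - axialAvg n α (fun t => P (n • w + q + Pi.single ν 1 - t)) v
        - axialAvg n α (fun t => P (n • w + q + Pi.single μ 1 - t)) v
        + axialAvg n α (fun t => P (n • w + q - t)) v|
      = ∑ q ∈ box 4 n, |((n : ℝ))⁻¹ * ∑ j ∈ Finset.range n, D (n • w + q - (j : ℤ) • (Pi.single α (1 : ℤ) : Pt))| :=
        Finset.sum_congr rfl fun q _ => by rw [hcomb]
    _ ≤ ∑ q ∈ box 4 n, ((n : ℝ))⁻¹ * ∑ j ∈ Finset.range n, |D (n • w + q - (j : ℤ) • (Pi.single α (1 : ℤ) : Pt))| := by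
        refine Finset.sum_le_sum fun q _ => ?_
        rw [abs_mul, abs_of_pos (inv_pos.mpr hn0)]
        exact mul_le_mul_of_nonneg_left (Finset.abs_sum_le_sum_abs _ _) (inv_pos.mpr hn0).le
    _ = ((n : ℝ))⁻¹ * ∑ j ∈ Finset.range n, ∑ q ∈ box 4 n, |D (n • w + q - (j : ℤ) • (Pi.single α (1 : ℤ) : Pt))| := by
        rw [← Finset.mul_sum, Finset.sum_comm]
    _ ≤ ((n : ℝ))⁻¹ * ∑ _j ∈ Finset.range n, (9 * 82944 * C₁ / ((supNorm (v - w) : ℝ) + 1) ^ 3) := by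
        refine mul_le_mul_of_nonneg_left (Finset.sum_le_sum fun j hj => ?_) (inv_pos.mpr hn0).le
        have hj' : j < n := Finset.mem_range.mp hj
        have hsh := sum_box_shift_le (fun x => |D x|) (fun _ => abs_nonneg _) w α hj'
        refine hsh.trans ?_
        have hw0 := hblk w
        have hw1 := hblk (w - Pi.single α 1)
        -- the neighbouring block: `‖v − (w − e)‖ + 1 ≤ 2(‖v − w‖ + 1)` ⟹ factor 8
        set m : ℝ := (supNorm (v - w) : ℝ) + 1 with hm
        have hm0 : 0 < m := by positivity
        have htri : (supNorm (v - w) : ℝ) ≤ supNorm (v - (w - Pi.single α 1)) + 1 := by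
          have h := supNorm_le_supNorm_sub_add (v - w) (-(Pi.single α (1 : ℤ) : Pt))
          rw [show v - w - -(Pi.single α (1 : ℤ) : Pt) = v - (w - Pi.single α 1) by abel, supNorm_neg] at h
          have h1 : supNorm (Pi.single α (1 : ℤ) : Pt) ≤ 1 := by
            rw [supNorm_le_iff]; intro i; by_cases hi : i = α
            · subst hi; simp
            · simp [hi]
          exact_mod_cast h.trans (Nat.add_le_add_left h1 _)
        have h8 : 82944 * C₁ / ((supNorm (v - (w - Pi.single α 1)) : ℝ) + 1) ^ 3 ≤ 8 * (82944 * C₁) / m ^ 3 := by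
          rw [div_le_div_iff₀ (by positivity) (by positivity)]
          have : m ≤ 2 * ((supNorm (v - (w - Pi.single α 1)) : ℝ) + 1) := by
            rw [hm]
            have := (Nat.cast_nonneg (supNorm (v - (w - Pi.single α 1))) : (0 : ℝ) ≤ _)
            linarith
          have h3 : m ^ 3 ≤ 8 * ((supNorm (v - (w - Pi.single α 1)) : ℝ) + 1) ^ 3 := by
            calc m ^ 3 ≤ (2 * ((supNorm (v - (w - Pi.single α 1)) : ℝ) + 1)) ^ 3 := pow_le_pow_left₀ hm0.le this 3
              _ = 8 * ((supNorm (v - (w - Pi.single α 1)) : ℝ) + 1) ^ 3 := by ring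
          nlinarith [mul_nonneg hC (sub_nonneg.mpr h3)]
        calc ∑ q ∈ box 4 n, |D (n • w + q)| + ∑ q ∈ box 4 n, |D (n • (w - Pi.single α 1) + q)|
            ≤ 82944 * C₁ / m ^ 3 + 8 * (82944 * C₁) / m ^ 3 := add_le_add hw0 (hw1.trans h8)
          _ = 9 * 82944 * C₁ / m ^ 3 := by ring
    _ = 9 * 82944 * C₁ / ((supNorm (v - w) : ℝ) + 1) ^ 3 := by
        rw [Finset.sum_const, Finset.card_range, nsmul_eq_mul]
        field_simp

end

end Summit.QuantumFields.BalabanUV.Beta.FP.BlockAveragedRemainderWindow
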